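import Summits.ResolutionOfSingularities.ResolutionOfSingularities.Theorems.PurelyInseparableDim4ParamCertNine
import HarnessLib

/-!
# [OURS · res-dim4-pi · F4-C-loc] PARAMETRIC CERTIFICATES, format v9 (part 2: SOUNDNESS and ROWS): the node-level torus step is
  sound (`Torus.rWins_C_mul_scale_iff` applied to every completion of B's reply); rows `eight c | move S charts` with external rows

Cell `res-dim4-pi` (D-0157 DOOR 2, wave 2), seat `res-dim4-p-6` g4; sequel of `…ParamCertNine`.

* §1 `pwin_of_memRowT`; §2 **`pnode9_sound`** — the v6 argument verbatim for the v6 constructors (data `G`, letter `β ≠ 0`,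
  `X = spec f β (evalT G)` = the chart transform translated by the coordinates pinned so far), plus the `torusN` case:
  `X = β^N·(X₁)(νx)` with `X₁` the representative's polynomial and `ν = β^{−w}` (`spec_eq_C_mul_scale_of_affine`), the
  completion `b` of the reply against `X` is the completion `ν•b` against `X₁` (`Torus.translate_scale`), low coefficients and
  cleaning transport (`Torus.coeff_scale`, `Torus.deletePthPowers_scale`), and the resulting state is the twist of the
  representative's — `Torus.rWins_C_mul_scale_iff`.
* §3 rows: `PRowCert9 := eight (c : PRowCert8 k) | move S charts` (charts `PNode9`), `proj8`, **`pcert9B q ext T`**,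
  **`pwin_of_pcert9B`**, `rows_certified_of_pcert9B`, entry **`rWins_liftState_of_pcert9B`**.

[OURS · counted 0 · certificate soundness; AI kernel work, weaker than expert review.]  NOTHING here is a statement about
resolution of singularities; resolution in dimension `≥ 4` / characteristic `p > 0` is NOT proved by anything in this
file.  bears_on: LADDER-RESOLUTION:D157-DOOR2 (res-dim4-pi · F4-C-loc all fields · trees v9).  Host item (DR-157-C):
`stmt-ResolutionOfSingularities-16155`, helper.
-/

set_option linter.dupNamespace false -- mandated namespace of this single-conjunct summit

noncomputable section

open MvPolynomial Finset
open scoped BigOperators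

namespace Summit.ResolutionOfSingularities.ResolutionOfSingularities.Theorems.PIDim4

namespace LoopCLocal

open Literature.AlgebraicGeometry.Resolution
open Literature.AlgebraicGeometry.Resolution.Hauser2010
open Literature.AlgebraicGeometry.Resolution.CentreBlowup
open StepKit ParamLift

variable {k K : Type} [Field k] [Field K] [DecidableEq k] [DecidableEq K] (f : k →+* K)

/-! ## §1 Glue -/

/-- a certified term list presenting the same polynomial certifies it. OURS. [folklore] -/
theorem pwin_of_memRowT {q : ℕ} {rows : List (Terms 5 k)}
    (hrows : ∀ L ∈ rows, (∀ β : K, β ≠ 0 → ∀ (r : Fin 4 →₀ ℕ) (exc : Finset (Fin 4)),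
      RWins q localB (⟨spec f β (evalT L), r, exc⟩ : State K))) {L : Terms 5 k}
    (h : memRowT L rows = true) :
    (∀ β : K, β ≠ 0 → ∀ (r : Fin 4 →₀ ℕ) (exc : Finset (Fin 4)),
      RWins q localB (⟨spec f β (evalT L), r, exc⟩ : State K)) := by
  obtain ⟨r, hr, hrc⟩ := List.any_eq_true.mp h
  intro β hβ rr exc
  rw [(evalT_eq_iff_equivB _ _).mpr hrc]
  exact hrows r hr β hβ rr exc

/-! ## §2 Soundness of the v9 trees -/

section Tree

variable {q : ℕ} {rows : List (Terms 5 k)}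

/-- **soundness of a v6 tree** (by height; invariant as in v6: data `G`, letter `β ≠ 0`, `X = spec f β (evalT G)`). OURS. [folklore] -/
theorem pnode9_sound_aux
    (hrows : ∀ L ∈ rows, (∀ β : K, β ≠ 0 → ∀ (r : Fin 4 →₀ ℕ) (exc : Finset (Fin 4)),
      RWins q localB (⟨spec f β (evalT L), r, exc⟩ : State K))) (n : ℕ) :
    ∀ (t : PNode9 k), pheight9 t < n → ∀ (G : Terms 5 k) (U : Finset (Fin 4)) (β : K) (X : MvPolynomial (Fin 4) K),
      β ≠ 0 → spec f β (evalT G) = X → pnode9B q rows G U t = true →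
      ∀ b : Fin 4 → K, (∀ m : Fin 4, m ∉ U → b m = 0) →
        (∀ γ : Fin 4 → ℕ, γ ≠ 0 → (∑ i, γ i) < q → coeff (expo γ) (PointBlowup.translate b X) = 0) →
        deletePthPowers q (PointBlowup.translate b X) ≠ 0 →
        ∀ (r : Fin 4 →₀ ℕ) (exc : Finset (Fin 4)),
          RWins q localB (⟨deletePthPowers q (PointBlowup.translate b X), r, exc⟩ : State K) := by
  induction n with
  | zero => intro t ht; exact absurd ht (Nat.not_lt_zero _)
  | succ n ih =>
  intro t ht G U β X hβ hX h b hb hlow hne r exc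
  cases t with
  | dead γ =>
    simp only [pnode9B] at h
    have hnz := coeff_ne_zero_of_pwitB f β hβ h hb
    rw [hX] at hnz
    exact absurd (hlow γ (pwitB_low h).1 (pwitB_low h).2) hnz
  | child =>
    simp only [pnode9B, Bool.and_eq_true, decide_eq_true_eq] at h
    obtain ⟨hU, hchild⟩ := h
    subst hU
    have hb0 := eq_zero_of_vanish hb
    subst hb0
    rw [PointBlowup.translate_zero] at hne ⊢
    have hF : deletePthPowers q X = spec f β (evalT (clean4 q G)) := by rw [← hX, deletePthPowers_spec]
    unfold pchildT at hchild
    rw [Bool.or_eq_true] at hchild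
    rcases hchild with hzero | hmem
    · exfalso; apply hne; rw [hF, (evalT_eq_zero_iff _).mpr hzero, map_zero]
    · rw [hF]; exact pwin_of_memRowT f hrows hmem β hβ r exc
  | free i zero letter =>
    simp only [pnode9B, Bool.and_eq_true, decide_eq_true_eq] at h
    obtain ⟨⟨⟨-, htf⟩, hzero⟩, hletter⟩ := h
    rw [pheight9] at ht
    by_cases hbi : b i = 0
    · exact ih zero (by omega) G (U.erase i) β X hβ hX hzero b (vanish_erase_of_eq hb hbi) hlow hne r exc
    · have hX' : spec f (b i) (evalT (normT (shearL i G))) = PointBlowup.translate (Pi.single i (b i)) X := by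
        rw [evalT_normT, ← shearAlg_evalT, ← translate_single_spec, spec_eq_of_tfree f htf (b i) β, hX]
      have htr : PointBlowup.translate b X =
          PointBlowup.translate (Function.update b i 0) (PointBlowup.translate (Pi.single i (b i)) X) := by
        rw [MohAlong.translate_translate, ← eq_update_add_single]
      rw [htr] at hlow hne ⊢
      exact ih letter (by omega) _ (U.erase i) (b i) _ hbi hX' hletter _ (vanish_update_erase hb i) hlow hne r exc
  | roots γ i tr M A d₀ zero rts qds =>
    simp only [pnode9B, Bool.and_eq_true, Bool.or_eq_true, decide_eq_true_eq] at h
    obtain ⟨⟨⟨⟨hroots, hz⟩, hrts⟩, htfq⟩, hqds⟩ := h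
    rw [pheight9] at ht
    have hcases := coord_cases_of_prootsMB f β hβ hroots hb
      (by rw [hX]; exact hlow γ (prootsMB_low hroots).1 (prootsMB_low hroots).2)
    rcases hcases with ⟨hd₀, hbi⟩ | ⟨ρm, hρm, hbi⟩ | ⟨htr, c, hc, hbi⟩
    · have hzero : pnode9B q rows G (U.erase i) zero = true := hz.resolve_left (by omega)
      exact ih zero (by omega) G (U.erase i) β X hβ hX hzero b (vanish_erase_of_eq hb hbi) hlow hne r exc
    · obtain ⟨⟨ρm', t'⟩, hmem, hfst⟩ := List.mem_map.mp hρm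
      simp only at hfst
      subst hfst
      have hnode := pnode9B_of_mem_roots rts hrts ρm' t' hmem
      have hlt : pheight9 t' < n := by have := pheight9_le_of_memR rts ρm' t' hmem; omega
      have hX' : spec f β (evalT (normT (shearMonoL i ρm'.1 tr G))) =
          PointBlowup.translate (Pi.single i (b i)) X := by
        rw [evalT_normT, ← shearMonoAlg_evalT, ← translate_mono_spec, hX, hbi]
      have htr : PointBlowup.translate b X =
          PointBlowup.translate (Function.update b i 0) (PointBlowup.translate (Pi.single i (b i)) X) := by
        rw [MohAlong.translate_translate, ← eq_update_add_single]
      rw [htr] at hlow hne ⊢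
      exact ih t' hlt _ (U.erase i) β _ hβ hX' hnode _ (vanish_update_erase hb i) hlow hne r exc
    · obtain ⟨⟨c', t'⟩, hmem, hfst⟩ := List.mem_map.mp hc
      simp only at hfst
      subst hfst
      obtain ⟨htf', hnode⟩ := pnode9B_of_mem_quads qds hqds c' t' hmem
      have hlt : pheight9 t' < n := by have := pheight9_le_of_memQ qds c' t' hmem; omega
      have htfG : tfreeB G = true :=
        htfq.resolve_left (by intro h0; rw [h0] at hmem; exact List.not_mem_nil hmem)
      have hX' : spec f β (evalT (normT (reduceQ c'.1 c'.2.1 (shearL i G)))) =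
          PointBlowup.translate (Pi.single i (b i)) X := by
        rw [spec_eq_of_tfree f htf' β (b i), evalT_normT, spec_reduceQ f c'.1 c'.2.1 hbi, ← shearAlg_evalT,
          ← translate_single_spec, spec_eq_of_tfree f htfG (b i) β, hX]
      have htr : PointBlowup.translate b X =
          PointBlowup.translate (Function.update b i 0) (PointBlowup.translate (Pi.single i (b i)) X) := by
        rw [MohAlong.translate_translate, ← eq_update_add_single]
      rw [htr] at hlow hne ⊢
      exact ih t' hlt _ (U.erase i) β _ hβ hX' hnode _ (vanish_update_erase hb i) hlow hne r exc
  | pair γ i i' ρ d zero letter =>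
    simp only [pnode9B, Bool.and_eq_true] at h
    obtain ⟨⟨⟨htf, hpair⟩, hzero⟩, hletter⟩ := h
    rw [pheight9] at ht
    have htie := coord_eq_of_ppairB f β hβ hpair hb
      (by rw [hX]; exact hlow γ (ppairB_low hpair).1 (ppairB_low hpair).2)
    have hii' := ppairB_ne hpair
    by_cases hbi' : b i' = 0
    · exact ih zero (by omega) G (U.erase i') β X hβ hX hzero b (vanish_erase_of_eq hb hbi') hlow hne r exc
    · have hX' : spec f (b i') (evalT (normT (shearMonoL i ρ d (shearL i' G)))) =
          PointBlowup.translate (Pi.single i' (b i') + Pi.single i (f ρ * b i' ^ d)) X := by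
        rw [evalT_normT, ← shearMonoAlg_evalT, ← shearAlg_evalT, ← translate_pair_spec f (b i') hii',
          spec_eq_of_tfree f htf (b i') β, hX]
      have htr : PointBlowup.translate b X = PointBlowup.translate (Function.update (Function.update b i' 0) i 0)
          (PointBlowup.translate (Pi.single i' (b i') + Pi.single i (f ρ * b i' ^ d)) X) := by
        rw [MohAlong.translate_translate, ← eq_update2_add_pair hii' htie]
      rw [htr] at hlow hne ⊢
      exact ih letter (by omega) _ ((U.erase i).erase i') (b i') _ hbi' hX' hletter _ (vanish_update2_erase hb i i')
        hlow hne r exc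
  | rel γ γ' zs nu κ subs =>
    simp only [pnode9B, Bool.and_eq_true, decide_eq_true_eq] at h
    obtain ⟨⟨hrel, hcov⟩, hforest⟩ := h
    rw [pheight9] at ht
    obtain ⟨i, hi, hbi⟩ := exists_zero_of_prelB f β hβ hrel hb
      (by rw [hX]; exact hlow γ (prelB_low hrel).1.1 (prelB_low hrel).1.2)
      (by rw [hX]; exact hlow γ' (prelB_low hrel).2.1 (prelB_low hrel).2.2)
    have hi' := hcov hi
    rw [List.mem_toFinset, List.mem_map] at hi'
    obtain ⟨⟨i₀, t'⟩, hmem, hi₀⟩ := hi'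
    simp only at hi₀
    subst hi₀
    have hlt : pheight9 t' < n := by have := pheight9_le_of_memL subs i₀ t' hmem; omega
    exact ih t' hlt G (U.erase i₀) β X hβ hX (pnode9B_of_mem_forest subs U hforest i₀ t' hmem) b
      (vanish_erase_of_eq hb hbi) hlow hne r exc
  | split γ subs =>
    simp only [pnode9B, Bool.and_eq_true] at h
    obtain ⟨hsplit, hforest⟩ := h
    rw [pheight9] at ht
    obtain ⟨i, hi, hbi⟩ := exists_zero_of_psplitB f β hβ hsplit hb
      (by rw [hX]; exact hlow γ (psplitB_low hsplit).1 (psplitB_low hsplit).2)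
    rw [List.mem_toFinset, List.mem_map] at hi
    obtain ⟨⟨i₀, t'⟩, hmem, hi₀⟩ := hi
    simp only at hi₀
    subst hi₀
    have hlt : pheight9 t' < n := by have := pheight9_le_of_memL subs i₀ t' hmem; omega
    exact ih t' hlt G (U.erase i₀) β X hβ hX (pnode9B_of_mem_forest subs U hforest i₀ t' hmem) b
      (vanish_erase_of_eq hb hbi) hlow hne r exc
  | torusN w N sub =>
    simp only [pnode9B, Bool.and_eq_true, decide_eq_true_eq] at h
    obtain ⟨haff, hsub⟩ := h
    rw [pheight9] at ht
    -- the data is `β^N · (representative)(ν x)`, `ν = β^{-w}`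
    set c : K := β ^ N with hc
    set ν : Fin 4 → K := fun i => β ^ (-w i) with hν
    have hc0 : c ≠ 0 := zpow_ne_zero _ hβ
    have hν0 : ∀ i, ν i ≠ 0 := fun i => zpow_ne_zero _ hβ
    have hX1 : spec f β (evalT (normT (setT0 G))) = spec f β (evalT (normT (setT0 G))) := rfl
    have hXeq : X = C c * aeval (fun i => C (ν i) * MvPolynomial.X i) (spec f β (evalT (normT (setT0 G)))) := by
      rw [← hX, evalT_normT, spec_eq_C_mul_scale_of_affine f hβ G haff]
    -- the reply `b` against `X` is the reply `ν • b` against the representative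
    have htr : PointBlowup.translate b X = C c * aeval (fun i => C (ν i) * MvPolynomial.X i)
        (PointBlowup.translate (fun i => ν i * b i) (spec f β (evalT (normT (setT0 G))))) := by
      rw [hXeq, PointBlowup.translate_C_mul, Torus.translate_scale]
    have hb' : ∀ m : Fin 4, m ∉ U → (fun i => ν i * b i) m = 0 := fun m hm => by
      show ν m * b m = 0
      rw [hb m hm, mul_zero]
    have hlow' : ∀ γ : Fin 4 → ℕ, γ ≠ 0 → (∑ i, γ i) < q →
        coeff (expo γ) (PointBlowup.translate (fun i => ν i * b i) (spec f β (evalT (normT (setT0 G))))) = 0 := by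
      intro γ h0 hdeg
      have hz := hlow γ h0 hdeg
      rw [htr, coeff_C_mul, Torus.coeff_scale] at hz
      rcases mul_eq_zero.mp hz with h1 | h2
      · exact absurd h1 hc0
      · exact (mul_eq_zero.mp h2).resolve_left (Torus.prod_pow_ne_zero hν0 _)
    have hne' : deletePthPowers q (PointBlowup.translate (fun i => ν i * b i)
        (spec f β (evalT (normT (setT0 G))))) ≠ 0 := by
      intro h0
      apply hne
      rw [htr, Torus.deletePthPowers_C_mul, Torus.deletePthPowers_scale, h0, map_zero, mul_zero]
    have hw := ih sub (by omega) (normT (setT0 G)) U β _ hβ hX1 hsub (fun i => ν i * b i) hb' hlow' hne' r exc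
    rw [htr, Torus.deletePthPowers_C_mul, Torus.deletePthPowers_scale]
    exact (Torus.rWins_C_mul_scale_iff hc0 hν0 _ r exc).mpr hw

/-- **soundness of a v9 chart tree at the chart root**: every equimultiple reply `b` vanishing off `U` in the chart `j`
leads to a won position (or is impossible). OURS. [folklore] -/
theorem pnode9_sound
    (hrows : ∀ L ∈ rows, (∀ β : K, β ≠ 0 → ∀ (r : Fin 4 →₀ ℕ) (exc : Finset (Fin 4)),
      RWins q localB (⟨spec f β (evalT L), r, exc⟩ : State K))) {β : K} (hβ : β ≠ 0) {L : Terms 5 k}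
    {S : Finset (Fin 4)} {j : Fin 4} (r : Fin 4 →₀ ℕ) (exc : Finset (Fin 4)) (t : PNode9 k) (U : Finset (Fin 4))
    (h : pnode9B q rows (chartL q (S5 S) j.castSucc L) U t = true) (b : Fin 4 → K)
    (hb : ∀ m : Fin 4, m ∉ U → b m = 0) (heq : IsEquimultiplePoint q S j b (⟨spec f β (evalT L), r, exc⟩ : State K))
    (hne : (CentreBlowup.step q S j b (⟨spec f β (evalT L), r, exc⟩ : State K)).F ≠ 0) :
    RWins q localB (CentreBlowup.step q S j b (⟨spec f β (evalT L), r, exc⟩ : State K)) := by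
  set s' := CentreBlowup.step q S j b (⟨spec f β (evalT L), r, exc⟩ : State K) with hs'
  have hX : spec f β (evalT (chartL q (S5 S) j.castSucc L)) = chartTransform q S j (spec f β (evalT L)) :=
    (chartTransform_spec f β q S j L).symm
  have hF : s'.F = deletePthPowers q (PointBlowup.translate b (chartTransform q S j (spec f β (evalT L)))) :=
    DivClock.step_F_eq q S j b _
  have hlow : ∀ γ : Fin 4 → ℕ, γ ≠ 0 → (∑ i, γ i) < q →
      coeff (expo γ) (PointBlowup.translate b (chartTransform q S j (spec f β (evalT L)))) = 0 := fun γ h0 hdeg =>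
    heq (expo γ) ((not_congr (expo_eq_zero_iff γ)).mpr h0) (by rw [degree_expo]; exact hdeg)
  have hw := pnode9_sound_aux f hrows (pheight9 t + 1) t (Nat.lt_succ_self _) _ U β _ hβ hX h b hb hlow
    (by rw [← hF]; exact hne) s'.r s'.exc
  rw [← hF] at hw
  exact hw

end Tree

/-! ## §3 Rows, tables, entry point -/

section Rows

variable {k : Type} [Field k] [DecidableEq k]

/-- a v9 row certificate. OURS. [folklore] -/
inductive PRowCert9 (k : Type) : Type
  /-- a v8 row (seven | pinq) -/
  | eight (c : PRowCert8 k)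
  /-- A plays `V(x_S)`; a v9 chart tree for every `j ∈ S` -/
  | move (S : Finset (Fin 4)) (charts : Fin 4 → PNode9 k)

/-- a v9 row. OURS. [folklore] -/
abbrev PRow9 (k : Type) : Type := Terms 5 k × PRowCert9 k

/-- projection to v8 rows (dummy certificates; only the term lists are read). OURS. [folklore] -/
def proj8 (rest : List (PRow9 k)) : List (PRow8 k) :=
  rest.map fun r => (r.1, PRowCert8.seven (PRowCert7.six (PRowCert6.move ∅ fun _ => PNode6.child)))

/-- the v9 row check (with external rows). OURS. [folklore] -/
def prow9B (q : ℕ) (ext : List (Terms 5 k)) (rest : List (PRow9 k)) : PRow9 k → Bool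
  | (L, PRowCert9.eight c) => prow8B q ext (proj8 rest) (L, c)
  | (L, PRowCert9.move S ch) => ppermB q S L &&
      decide (∀ j ∈ S, pnode9B q (rest.map Prod.fst ++ ext) (chartL q (S5 S) j.castSucc L) (S.erase j) (ch j) = true)

/-- **the v9 certificate checker** (with external rows). OURS. [folklore] -/
def pcert9B (q : ℕ) (ext : List (Terms 5 k)) : List (PRow9 k) → Bool
  | [] => true
  | row :: rest => prow9B q ext rest row && pcert9B q ext rest

end Rows

section RowsSound

variable {k K : Type} [Field k] [Field K] [DecidableEq k] [DecidableEq K] (f : k →+* K)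

omit [DecidableEq k] in
/-- the induction hypothesis descends to the v8 projection. OURS. [folklore] -/
theorem hrest_proj8 {q : ℕ} {rest : List (PRow9 k)}
    (hrest : ∀ row ∈ rest, (∀ β : K, β ≠ 0 → ∀ (r : Fin 4 →₀ ℕ) (exc : Finset (Fin 4)),
      RWins q localB (⟨spec f β (evalT row.1), r, exc⟩ : State K))) :
    ∀ row ∈ proj8 rest, (∀ β : K, β ≠ 0 → ∀ (r : Fin 4 →₀ ℕ) (exc : Finset (Fin 4)),
      RWins q localB (⟨spec f β (evalT row.1), r, exc⟩ : State K)) := by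
  intro row hrow
  unfold proj8 at hrow
  obtain ⟨r, hr, rfl⟩ := List.mem_map.mp hrow
  exact hrest r hr

omit [DecidableEq k] in
/-- the term lists of the later rows and the external rows are certified. OURS. [folklore] -/
theorem hrows_of_rest_ext {q : ℕ} {rest : List (PRow9 k)} {ext : List (Terms 5 k)}
    (hrest : ∀ row ∈ rest, (∀ β : K, β ≠ 0 → ∀ (r : Fin 4 →₀ ℕ) (exc : Finset (Fin 4)),
      RWins q localB (⟨spec f β (evalT row.1), r, exc⟩ : State K)))
    (hext : ∀ L ∈ ext, (∀ β : K, β ≠ 0 → ∀ (r : Fin 4 →₀ ℕ) (exc : Finset (Fin 4)),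
      RWins q localB (⟨spec f β (evalT L), r, exc⟩ : State K))) :
    ∀ L ∈ rest.map Prod.fst ++ ext, (∀ β : K, β ≠ 0 → ∀ (r : Fin 4 →₀ ℕ) (exc : Finset (Fin 4)),
      RWins q localB (⟨spec f β (evalT L), r, exc⟩ : State K)) := by
  intro L hL
  rcases List.mem_append.mp hL with h | h
  · obtain ⟨row, hrow, rfl⟩ := List.mem_map.mp h
    exact hrest row hrow
  · exact hext L h

/-- **soundness of one v9 row.** OURS. [folklore] -/
theorem pwin_of_prow9B {q : ℕ} (hq : 2 ≤ q) {ext : List (Terms 5 k)} {rest : List (PRow9 k)}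
    (hrest : ∀ row ∈ rest, (∀ β : K, β ≠ 0 → ∀ (r : Fin 4 →₀ ℕ) (exc : Finset (Fin 4)),
      RWins q localB (⟨spec f β (evalT row.1), r, exc⟩ : State K)))
    (hext : ∀ L ∈ ext, (∀ β : K, β ≠ 0 → ∀ (r : Fin 4 →₀ ℕ) (exc : Finset (Fin 4)),
      RWins q localB (⟨spec f β (evalT L), r, exc⟩ : State K))) {row : PRow9 k}
    (h : prow9B q ext rest row = true) :
    (∀ β : K, β ≠ 0 → ∀ (r : Fin 4 →₀ ℕ) (exc : Finset (Fin 4)),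
      RWins q localB (⟨spec f β (evalT row.1), r, exc⟩ : State K)) := by
  obtain ⟨L, cert⟩ := row
  intro β hβ r exc
  cases cert with
  | eight c =>
    simp only [prow9B] at h
    exact pwin_of_prow8B f hq (hrest_proj8 f hrest) hext h β hβ r exc
  | move S ch =>
    simp only [prow9B, Bool.and_eq_true, decide_eq_true_eq] at h
    obtain ⟨hperm, hall⟩ := h
    have hrows := hrows_of_rest_ext f hrest hext
    by_cases hsc : InCoordinateScope q (spec f β (evalT L))
    · refine Game.Wins.move (m := S) ⟨hsc, isPermissibleCentre_spec f β hperm⟩ ?_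
      rintro s' ⟨j, b, hj, hbj, hloc, heq, hne, rfl⟩
      exact pnode9_sound f hrows hβ r exc (ch j) (S.erase j) (hall j hj) b
        (vanish_erase K hbj ((localB_eq_true_iff S j b).mp hloc)) heq hne
    · exact Game.Wins.terminal fun _ hS' => hsc hS'.1

/-- **SOUNDNESS OF v9 CERTIFICATES** (external rows certified by `hext`). OURS. [folklore] -/
theorem pwin_of_pcert9B {q : ℕ} (hq : 2 ≤ q) {ext : List (Terms 5 k)}
    (hext : ∀ L ∈ ext, (∀ β : K, β ≠ 0 → ∀ (r : Fin 4 →₀ ℕ) (exc : Finset (Fin 4)),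
      RWins q localB (⟨spec f β (evalT L), r, exc⟩ : State K))) :
    ∀ {T : List (PRow9 k)}, pcert9B q ext T = true → ∀ row ∈ T,
      (∀ β : K, β ≠ 0 → ∀ (r : Fin 4 →₀ ℕ) (exc : Finset (Fin 4)),
        RWins q localB (⟨spec f β (evalT row.1), r, exc⟩ : State K))
  | [], _ => fun row hrow => absurd hrow List.not_mem_nil
  | row :: rest, h => by
    unfold pcert9B at h
    rw [Bool.and_eq_true] at h
    have hrest := pwin_of_pcert9B hq hext h.2
    intro r hr
    rcases List.mem_cons.mp hr with rfl | hr'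
    · exact pwin_of_prow9B f hq hrest hext h.1
    · exact hrest r hr'

/-- **chaining form**: the term lists of a checked v9 table are certified. OURS. [folklore] -/
theorem rows_certified_of_pcert9B {q : ℕ} (hq : 2 ≤ q) {ext : List (Terms 5 k)}
    (hext : ∀ L ∈ ext, (∀ β : K, β ≠ 0 → ∀ (r : Fin 4 →₀ ℕ) (exc : Finset (Fin 4)),
      RWins q localB (⟨spec f β (evalT L), r, exc⟩ : State K))) {T : List (PRow9 k)} (h : pcert9B q ext T = true) :
    ∀ L ∈ T.map Prod.fst, (∀ β : K, β ≠ 0 → ∀ (r : Fin 4 →₀ ℕ) (exc : Finset (Fin 4)),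
      RWins q localB (⟨spec f β (evalT L), r, exc⟩ : State K)) := by
  intro L hL
  obtain ⟨row, hrow, rfl⟩ := List.mem_map.mp hL
  exact pwin_of_pcert9B f hq hext h row hrow

end RowsSound

/-- **an `𝔽₃` state whose embedding heads a checked v9 table (external rows certified) is a LOCAL A-win over the field `L` of
characteristic 3.** OURS. [folklore] -/
theorem rWins_liftState_of_pcert9B (L : Type) [Field L] [CharP L 3] [DecidableEq L] {ext : List (Terms 5 (ZMod 3))}
    (hext : ∀ T5 ∈ ext, (∀ β : L, β ≠ 0 → ∀ (r : Fin 4 →₀ ℕ) (exc : Finset (Fin 4)),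
      RWins 3 localB (⟨spec (φ3 L) β (evalT T5), r, exc⟩ : State L)))
    {s : SData 4 (ZMod 3)} {cert : PRowCert9 (ZMod 3)} {rest : List (PRow9 (ZMod 3))}
    (h : pcert9B 3 ext ((embed s.L, cert) :: rest) = true) : RWins 3 localB (liftState L s.toState) := by
  have hw := pwin_of_pcert9B (φ3 L) (by norm_num) hext h (embed s.L, cert) List.mem_cons_self 1 one_ne_zero
    (expo s.r) s.exc
  rw [spec_embed] at hw
  exact hw

end LoopCLocal

end Summit.ResolutionOfSingularities.ResolutionOfSingularities.Theorems.PIDim4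

end
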